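import Mathlib.LinearAlgebra.Matrix.GeneralLinearGroup.Defs
import Mathlib.LinearAlgebra.Matrix.Notation
import Mathlib.Data.ZMod.Basic
import Mathlib.Tactic
import HarnessLib

/-!
# A subgroup of `GL₂(ℤ/8ℤ)` containing every square, attaining every determinant, and containing one
# matrix of determinant `1` whose reduction modulo `2` has order `2`, is all of `GL₂(ℤ/8ℤ)`

Route `GenusKolyvaginAtTwo` (BirchSwinnertonDyer), seat `bsd-line-gk2-p3` g15 (cell `bsd-f1-sign2`),
`--supports stmt-BirchSwinnertonDyer-28029` (helper; closes nothing). THEOREMS ONLY (no definition, no named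
fact, no `sorry`). BSD is not proved by any of this.

This is the GROUP THEORY of the `ℚ → K` transfer of `2`-power surjectivity (sequel
`GenusKolyvaginAtTwoShaCardDvdPowAtTwoRTwoPowerImageOverK.lean`): for an elliptic curve `E/ℚ` with
`ρ̄_{E,8} : Γ_ℚ → GL₂(ℤ/8)` onto and a quadratic field `K`, the image `M = ρ̄_{E,8}(Gal(ℚ̄/K))` contains every
square (`Gal(ℚ̄/K)` has index `2`); `M` is then all of `GL₂(ℤ/8)` as soon as it attains every determinant
(`K ∩ ℚ(ζ₈) = ℚ`) and contains one element of determinant `1` acting on `E[2]` as a transposition while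
fixing `ζ₈` — which the sequel produces from `√Δ, √−Δ, √2Δ, √−2Δ ∉ K`. The quotient of `GL₂(ℤ/8)` by the
subgroup generated by squares is `(ℤ/2)³` (sign of the reduction modulo `2` in `GL₂(𝔽₂) ≅ S₃`, and the
determinant in `(ℤ/8)ˣ = (ℤ/8)ˣ/(ℤ/8)ˣ²`), whence the seven quadratic subfields
`ℚ(√−1), ℚ(√±2), ℚ(√±Δ), ℚ(√±2Δ)` of `ℚ(E[8])` (Serre 1972 §5.3 for odd level; Rouse–Zureick-Brown 2015 §3).

* §1 realised matrices; every `(a, 2b; 2c, a + 4abc)` with `a² = 1` — i.e. every matrix of determinant `1`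
  congruent to `1` modulo `2` — is a product of three squares (`L · (a·1) · U` with `L = (1 0; ac 1)²`,
  `a·1 = (1 1; a−1 −1)²`, `U = (1 ab; 0 1)²`); the lift `s = (0 1; −1 −1)` of the `3`-cycle is `(s²)²`.
* §2 the six reductions modulo `2` and their representatives `1, s, s², u, us, us²` (`u = (1 1; 0 1)`);
  the normal form `g = w · B · diag(1, det g)` with `B ≡ 1 (mod 2)`, `det B = 1`.
* §3 `eq_top_of_sq_mem_of_det_of_transposition` — the theorem of the title.

References: [Serre1972] §5.3; [RouseZureickbrown2015] §3; [DokchitserDokchitserMathZ2012] Introduction.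
-/

set_option autoImplicit false
set_option linter.dupNamespace false

namespace Summit.BirchSwinnertonDyer.BirchSwinnertonDyer.Theorems.GenusExact.TwoPowerImageOverK

open Matrix

section LevelEight

variable {M : Subgroup (GL (Fin 2) (ZMod 8))}

/-! ## §1 Realised matrices; congruence matrices of determinant one are products of squares -/

/-- Matrices realised in `M` are closed under products. [folklore] -/
private theorem memMat_mul {A B : Matrix (Fin 2) (Fin 2) (ZMod 8)}
    (hA : ∃ g ∈ M, (g : Matrix (Fin 2) (Fin 2) (ZMod 8)) = A)
    (hB : ∃ g ∈ M, (g : Matrix (Fin 2) (Fin 2) (ZMod 8)) = B) :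
    ∃ g ∈ M, (g : Matrix (Fin 2) (Fin 2) (ZMod 8)) = A * B := by
  obtain ⟨g, hg, rfl⟩ := hA
  obtain ⟨h, hh, rfl⟩ := hB
  exact ⟨g * h, M.mul_mem hg hh, by rw [Units.val_mul]⟩

/-- The square of a matrix with unit determinant (in `ℤ/8` every unit squares to `1`) is realised in `M`
when `M` contains all squares. [folklore] -/
private theorem memMat_sq (hsq : ∀ g : GL (Fin 2) (ZMod 8), g * g ∈ M)
    (A : Matrix (Fin 2) (Fin 2) (ZMod 8)) (hA : A.det * A.det = 1) :
    ∃ g ∈ M, (g : Matrix (Fin 2) (Fin 2) (ZMod 8)) = A * A :=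
  ⟨_, hsq (Matrix.GeneralLinearGroup.mk'' A (IsUnit.of_mul_eq_one _ hA)), by
    rw [Units.val_mul]; rfl⟩

/-- An element of `GL₂(ℤ/8)` whose matrix is realised in `M` lies in `M`. [folklore] -/
private theorem mem_of_memMat {g : GL (Fin 2) (ZMod 8)}
    (h : ∃ g' ∈ M, (g' : Matrix (Fin 2) (Fin 2) (ZMod 8)) = g) : g ∈ M := by
  obtain ⟨g', hg', hgg'⟩ := h
  rwa [← Units.ext hgg']

/-- **Congruence matrices of determinant `1` are products of three squares**: for `a² = 1`,
`(a, 2b; 2c, a + 4abc) = (1 0; ac 1)² · (1 1; a−1 −1)² · (1 ab; 0 1)²` lies in `M`. [folklore] -/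
private theorem memMat_congruence (hsq : ∀ g : GL (Fin 2) (ZMod 8), g * g ∈ M) (a b c : ZMod 8)
    (ha : a * a = 1) :
    ∃ g ∈ M, (g : Matrix (Fin 2) (Fin 2) (ZMod 8)) = !![a, 2 * b; 2 * c, a + 4 * a * b * c] := by
  have h1 : !![a, 2 * b; 2 * c, a + 4 * a * b * c] =
      (!![1, 0; a * c, 1] * !![1, 0; a * c, 1]) *
        ((!![1, 1; a - 1, -1] * !![1, 1; a - 1, -1]) * (!![1, a * b; 0, 1] * !![1, a * b; 0, 1])) := by
    simp only [Matrix.mul_fin_two]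
    ext i j
    fin_cases i <;> fin_cases j
    · simp
    · simp; linear_combination (-(2 * b)) * ha
    · simp; linear_combination (-(2 * c)) * ha
    · simp; linear_combination (-(4 * a * b * c)) * ha
  rw [h1]
  refine memMat_mul (memMat_sq hsq _ ?_) (memMat_mul (memMat_sq hsq _ ?_) (memMat_sq hsq _ ?_))
  · simp [Matrix.det_fin_two_of]
  · rw [Matrix.det_fin_two_of]; linear_combination ha
  · simp [Matrix.det_fin_two_of]

/-- The lift `s = (0 1; −1 −1)` of the `3`-cycle of `GL₂(𝔽₂)` has `s³ = 1`, so `s = (s²)²` lies in `M`.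
[folklore] -/
private theorem memMat_s (hsq : ∀ g : GL (Fin 2) (ZMod 8), g * g ∈ M) :
    ∃ g ∈ M, (g : Matrix (Fin 2) (Fin 2) (ZMod 8)) = !![0, 1; -1, -1] := by
  have h : (!![0, 1; -1, -1] : Matrix (Fin 2) (Fin 2) (ZMod 8)) = !![-1, -1; 1, 0] * !![-1, -1; 1, 0] := by
    decide
  rw [h]
  exact memMat_sq hsq _ (by decide)

/-! ## §2 Reduction modulo `2` and the normal form -/

/-- The six elements of `GL₂(𝔽₂)`, as the reductions of `1, s, s², u, us, us²`. [folklore] -/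
private theorem fin_two_cases (x : GL (Fin 2) (ZMod 2)) :
    (x : Matrix (Fin 2) (Fin 2) (ZMod 2)) = 1 ∨ (x : Matrix (Fin 2) (Fin 2) (ZMod 2)) = !![0, 1; 1, 1] ∨
      (x : Matrix (Fin 2) (Fin 2) (ZMod 2)) = !![1, 1; 1, 0] ∨ (x : Matrix (Fin 2) (Fin 2) (ZMod 2)) = !![1, 1; 0, 1] ∨
      (x : Matrix (Fin 2) (Fin 2) (ZMod 2)) = !![1, 0; 1, 1] ∨ (x : Matrix (Fin 2) (Fin 2) (ZMod 2)) = !![0, 1; 1, 0] := by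
  have hdet : (x : Matrix (Fin 2) (Fin 2) (ZMod 2)).det = 1 := by
    have hu : IsUnit (x : Matrix (Fin 2) (Fin 2) (ZMod 2)).det := by
      rw [← Matrix.GeneralLinearGroup.val_det_apply]; exact Units.isUnit _
    have key : ∀ z : ZMod 2, IsUnit z → z = 1 := by decide
    exact key _ hu
  rw [Matrix.eta_fin_two (x : Matrix (Fin 2) (Fin 2) (ZMod 2))] at hdet ⊢
  rw [Matrix.det_fin_two_of] at hdet
  have key : ∀ a b c d : ZMod 2, a * d - b * c = 1 →
      (!![a, b; c, d] : Matrix (Fin 2) (Fin 2) (ZMod 2)) = 1 ∨ !![a, b; c, d] = !![0, 1; 1, 1] ∨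
        !![a, b; c, d] = !![1, 1; 1, 0] ∨ !![a, b; c, d] = !![1, 1; 0, 1] ∨ !![a, b; c, d] = !![1, 0; 1, 1] ∨
        !![a, b; c, d] = !![0, 1; 1, 0] := by
    decide
  exact key _ _ _ _ hdet

/-- Arithmetic of `ℤ/8`: an element reducing to `0` modulo `2` is a double. [folklore] -/
private theorem exists_eq_two_mul_of_cast_eq_zero (x : ZMod 8)
    (hx : ZMod.castHom (show 2 ∣ 8 by norm_num) (ZMod 2) x = 0) : ∃ y : ZMod 8, x = 2 * y := by
  revert x; decide

/-- Arithmetic of `ℤ/8`: an element reducing to `1` modulo `2` squares to `1`. [folklore] -/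
private theorem mul_self_eq_one_of_cast_eq_one (x : ZMod 8)
    (hx : ZMod.castHom (show 2 ∣ 8 by norm_num) (ZMod 2) x = 1) : x * x = 1 := by
  revert x; decide

/-- Arithmetic of `ℤ/8`: every unit squares to `1`. [folklore] -/
private theorem units_mul_self (u : (ZMod 8)ˣ) : (u : ZMod 8) * u = 1 := by
  have key : ∀ x : ZMod 8, IsUnit x → x * x = 1 := by decide
  exact key _ u.isUnit

/-- Arithmetic of `ℤ/8`: every unit reduces to `1` modulo `2`. [folklore] -/
private theorem cast_units_eq_one (u : (ZMod 8)ˣ) :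
    ZMod.castHom (show 2 ∣ 8 by norm_num) (ZMod 2) (u : ZMod 8) = 1 := by
  have key : ∀ x : ZMod 8, IsUnit x → ZMod.castHom (show 2 ∣ 8 by norm_num) (ZMod 2) x = 1 := by decide
  exact key _ u.isUnit

variable (red : GL (Fin 2) (ZMod 8) →* GL (Fin 2) (ZMod 2))
  (hred : ∀ (g : GL (Fin 2) (ZMod 8)) (i j : Fin 2), (red g : Matrix (Fin 2) (Fin 2) (ZMod 2)) i j =
    ZMod.castHom (show 2 ∣ 8 by norm_num) (ZMod 2) ((g : Matrix (Fin 2) (Fin 2) (ZMod 8)) i j))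

include hred in
/-- Reading the reduction of an explicit matrix. [folklore] -/
private theorem coe_red_eq {w : GL (Fin 2) (ZMod 8)} {X : Matrix (Fin 2) (Fin 2) (ZMod 2)}
    (hX : ∀ i j, ZMod.castHom (show 2 ∣ 8 by norm_num) (ZMod 2) ((w : Matrix (Fin 2) (Fin 2) (ZMod 8)) i j) = X i j) :
    (red w : Matrix (Fin 2) (Fin 2) (ZMod 2)) = X :=
  Matrix.ext fun i j ↦ by rw [hred, hX]

include hred in
/-- **Normal form.** If `w` reduces modulo `2` like `g` and `det w = 1`, then `w⁻¹ g · diag(1, det g)` is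
congruent to `1` modulo `2` with determinant `1`, hence lies in (is realised in) `M`:
`w · B = g · diag(1, det g)` for some `B ∈ M`. [folklore] -/
private theorem exists_mul_eq_mul_diag (hsq : ∀ g : GL (Fin 2) (ZMod 8), g * g ∈ M)
    (g w : GL (Fin 2) (ZMod 8)) (hw : red w = red g) (hdw : Matrix.GeneralLinearGroup.det w = 1) :
    ∃ B ∈ M, ((w * B : GL (Fin 2) (ZMod 8)) : Matrix (Fin 2) (Fin 2) (ZMod 8)) =
      (g : Matrix (Fin 2) (Fin 2) (ZMod 8)) * !![1, 0; 0, ((Matrix.GeneralLinearGroup.det g : (ZMod 8)ˣ) : ZMod 8)] := by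
  set d : (ZMod 8)ˣ := Matrix.GeneralLinearGroup.det g with hd
  set C : GL (Fin 2) (ZMod 8) := w⁻¹ * g with hC
  -- `C ≡ 1 (mod 2)`
  have hredC : red C = 1 := by rw [hC, map_mul, map_inv, hw, inv_mul_cancel]
  have hcast : ∀ i j, ZMod.castHom (show 2 ∣ 8 by norm_num) (ZMod 2) ((C : Matrix (Fin 2) (Fin 2) (ZMod 8)) i j) =
      (1 : Matrix (Fin 2) (Fin 2) (ZMod 2)) i j := fun i j ↦ by
    rw [← hred, hredC]; rfl
  -- `det C = d`
  have hdetC : (C : Matrix (Fin 2) (Fin 2) (ZMod 8)).det = (d : ZMod 8) := by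
    rw [← Matrix.GeneralLinearGroup.val_det_apply, hC, map_mul, map_inv, hdw, inv_one, one_mul]
  -- the entries of `A = C · diag(1, d)`
  set A : Matrix (Fin 2) (Fin 2) (ZMod 8) := (C : Matrix (Fin 2) (Fin 2) (ZMod 8)) * !![1, 0; 0, (d : ZMod 8)]
    with hA
  have hA' : A = !![(C : Matrix (Fin 2) (Fin 2) (ZMod 8)) 0 0, (C : Matrix (Fin 2) (Fin 2) (ZMod 8)) 0 1 * d;
      (C : Matrix (Fin 2) (Fin 2) (ZMod 8)) 1 0, (C : Matrix (Fin 2) (Fin 2) (ZMod 8)) 1 1 * d] := by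
    rw [hA, Matrix.eta_fin_two (C : Matrix (Fin 2) (Fin 2) (ZMod 8)), Matrix.mul_fin_two]
    ext i j
    fin_cases i <;> fin_cases j <;> simp
  have h00 : (C : Matrix (Fin 2) (Fin 2) (ZMod 8)) 0 0 * (C : Matrix (Fin 2) (Fin 2) (ZMod 8)) 0 0 = 1 :=
    mul_self_eq_one_of_cast_eq_one _ (by rw [hcast]; rfl)
  obtain ⟨b, hb⟩ : ∃ y : ZMod 8, (C : Matrix (Fin 2) (Fin 2) (ZMod 8)) 0 1 * d = 2 * y :=
    exists_eq_two_mul_of_cast_eq_zero _ (by rw [map_mul, hcast]; simp)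
  obtain ⟨c, hc⟩ : ∃ y : ZMod 8, (C : Matrix (Fin 2) (Fin 2) (ZMod 8)) 1 0 = 2 * y :=
    exists_eq_two_mul_of_cast_eq_zero _ (by rw [hcast]; rfl)
  -- `det A = d² = 1` pins the last entry
  have hdetA : (C : Matrix (Fin 2) (Fin 2) (ZMod 8)) 0 0 * ((C : Matrix (Fin 2) (Fin 2) (ZMod 8)) 1 1 * d) -
      (C : Matrix (Fin 2) (Fin 2) (ZMod 8)) 0 1 * d * (C : Matrix (Fin 2) (Fin 2) (ZMod 8)) 1 0 = 1 := by
    have h1 : A.det = 1 := by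
      have hdd := units_mul_self d
      rw [hA, Matrix.det_mul, hdetC, Matrix.det_fin_two_of]
      linear_combination hdd
    rwa [hA', Matrix.det_fin_two_of] at h1
  have h11 : (C : Matrix (Fin 2) (Fin 2) (ZMod 8)) 1 1 * d =
      (C : Matrix (Fin 2) (Fin 2) (ZMod 8)) 0 0 + 4 * (C : Matrix (Fin 2) (Fin 2) (ZMod 8)) 0 0 * b * c := by
    rw [hb, hc] at hdetA
    linear_combination (-((C : Matrix (Fin 2) (Fin 2) (ZMod 8)) 1 1 * d)) * h00 +
      (C : Matrix (Fin 2) (Fin 2) (ZMod 8)) 0 0 * hdetA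
  obtain ⟨B, hBM, hB⟩ := memMat_congruence hsq ((C : Matrix (Fin 2) (Fin 2) (ZMod 8)) 0 0) b c h00
  refine ⟨B, hBM, ?_⟩
  rw [Units.val_mul, hB, ← hb, ← hc, ← h11, ← hA']
  -- `w · (w⁻¹ g · D) = g · D`
  rw [hA, hC, Units.val_mul, ← Matrix.mul_assoc, ← Matrix.mul_assoc, ← Units.val_mul, mul_inv_cancel,
    Units.val_one, Matrix.one_mul]

/-! ## §3 The theorem -/

include hred in
/-- **A subgroup of `GL₂(ℤ/8ℤ)` containing every square, attaining every determinant, and containing a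
matrix of determinant `1` whose reduction modulo `2` is an involution `≠ 1` (a transposition of
`GL₂(𝔽₂) ≅ S₃`) is all of `GL₂(ℤ/8ℤ)`.** Proof: the subgroup `D` generated by the squares contains every
matrix `≡ 1 (mod 2)` of determinant `1` (`memMat_congruence`) and the lift `s` of the `3`-cycle; every `g`
is `w · B · diag(1, det g)` with `w ∈ {1, s, s², u, us, us²}` and `B ∈ D`; the transposition witness forces
`u ∈ M`, the determinant witnesses force every `diag(1, d) ∈ M`. (For an elliptic curve: the index-`8`
quotient `GL₂(ℤ/8)/D ≅ (ℤ/2)³` is `(sign mod 2, det mod squares)`, cutting out `ℚ(√Δ, √−1, √2) ⊆ ℚ(E[8])`.)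
[cite: Serre1972, §5.3 (the quadratic subfield cut out by det = χ)] [cite: RouseZureickbrown2015, §3] -/
theorem eq_top_of_sq_mem_of_det_of_transposition (M : Subgroup (GL (Fin 2) (ZMod 8)))
    (hsq : ∀ g : GL (Fin 2) (ZMod 8), g * g ∈ M)
    (hdet : ∀ d : (ZMod 8)ˣ, ∃ m ∈ M, Matrix.GeneralLinearGroup.det m = d)
    (hodd : ∃ m ∈ M, red m * red m = 1 ∧ red m ≠ 1 ∧ Matrix.GeneralLinearGroup.det m = 1) :
    M = ⊤ := by
  -- the lifts `s` of the `3`-cycle and `u` of a transposition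
  set gs : GL (Fin 2) (ZMod 8) := ⟨!![0, 1; -1, -1], !![-1, -1; 1, 0], by decide, by decide⟩ with hgs
  set gu : GL (Fin 2) (ZMod 8) := ⟨!![1, 1; 0, 1], !![1, -1; 0, 1], by decide, by decide⟩ with hgu
  have hgsM : gs ∈ M := mem_of_memMat (memMat_s hsq)
  have hdet1 : ∀ w : GL (Fin 2) (ZMod 8), (w : Matrix (Fin 2) (Fin 2) (ZMod 8)).det = 1 →
      Matrix.GeneralLinearGroup.det w = 1 := fun w h ↦
    Units.ext (by rw [Matrix.GeneralLinearGroup.val_det_apply, h, Units.val_one])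
  -- the six words and their reductions
  have hw1 : (red 1 : Matrix (Fin 2) (Fin 2) (ZMod 2)) = 1 := by rw [map_one]; rfl
  have hws : (red gs : Matrix (Fin 2) (Fin 2) (ZMod 2)) = !![0, 1; 1, 1] :=
    coe_red_eq red hred (by decide)
  have hwss : (red (gs * gs) : Matrix (Fin 2) (Fin 2) (ZMod 2)) = !![1, 1; 1, 0] :=
    coe_red_eq red hred (by rw [Units.val_mul]; decide)
  have hwu : (red gu : Matrix (Fin 2) (Fin 2) (ZMod 2)) = !![1, 1; 0, 1] :=
    coe_red_eq red hred (by decide)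
  have hwus : (red (gu * gs) : Matrix (Fin 2) (Fin 2) (ZMod 2)) = !![1, 0; 1, 1] :=
    coe_red_eq red hred (by rw [Units.val_mul]; decide)
  have hwuss : (red (gu * (gs * gs)) : Matrix (Fin 2) (Fin 2) (ZMod 2)) = !![0, 1; 1, 0] :=
    coe_red_eq red hred (by rw [Units.val_mul, Units.val_mul]; decide)
  have hword : ∀ g : GL (Fin 2) (ZMod 8), ∃ w : GL (Fin 2) (ZMod 8), red w = red g ∧
      Matrix.GeneralLinearGroup.det w = 1 ∧
      ((w = 1 ∨ w = gs ∨ w = gs * gs) ∨ (w = gu ∨ w = gu * gs ∨ w = gu * (gs * gs))) := by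
    intro g
    rcases fin_two_cases (red g) with h | h | h | h | h | h
    · exact ⟨1, Units.ext (hw1.trans h.symm), by rw [map_one], Or.inl (Or.inl rfl)⟩
    · exact ⟨gs, Units.ext (hws.trans h.symm), hdet1 _ (by decide), Or.inl (Or.inr (Or.inl rfl))⟩
    · exact ⟨gs * gs, Units.ext (hwss.trans h.symm), hdet1 _ (by rw [Units.val_mul]; decide),
        Or.inl (Or.inr (Or.inr rfl))⟩
    · exact ⟨gu, Units.ext (hwu.trans h.symm), hdet1 _ (by decide), Or.inr (Or.inl rfl)⟩
    · exact ⟨gu * gs, Units.ext (hwus.trans h.symm), hdet1 _ (by rw [Units.val_mul]; decide),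
        Or.inr (Or.inr (Or.inl rfl))⟩
    · exact ⟨gu * (gs * gs), Units.ext (hwuss.trans h.symm),
        hdet1 _ (by rw [Units.val_mul, Units.val_mul]; decide), Or.inr (Or.inr (Or.inr rfl))⟩
  -- `u ∈ M` from the transposition witness
  obtain ⟨m, hmM, hm2, hm1, hmdet⟩ := hodd
  have hguM : gu ∈ M := by
    obtain ⟨w, hw, hdw, hcases⟩ := hword m
    obtain ⟨B, hBM, hB⟩ := exists_mul_eq_mul_diag red hred hsq m w hw hdw
    have hwB : w * B = m := by
      refine Units.ext ?_
      rw [hB, hmdet, Units.val_one]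
      have : (!![1, 0; 0, 1] : Matrix (Fin 2) (Fin 2) (ZMod 8)) = 1 := by decide
      rw [this, Matrix.mul_one]
    have hwM : w ∈ M := by
      have : w = m * B⁻¹ := by rw [← hwB, mul_inv_cancel_right]
      rw [this]; exact M.mul_mem hmM (M.inv_mem hBM)
    rcases hcases with (rfl | rfl | rfl) | (rfl | rfl | rfl)
    · exact absurd (map_one red ▸ hw :  (1 : GL (Fin 2) (ZMod 2)) = red m).symm hm1
    · exfalso; apply hm1
      -- `red m = s̄` with `s̄² = s̄⁻¹ ≠ 1`: `s̄ · s̄ = 1` forces `s̄ = 1`... contradiction via matrices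
      have h3 : red gs * red gs * red gs = 1 := Units.ext (by
        rw [Units.val_mul, Units.val_mul, hws, Units.val_one]; decide)
      rw [hw, hm2, one_mul] at h3
      exact h3
    · exfalso; apply hm1
      have h3 : red (gs * gs) * red (gs * gs) * red (gs * gs) = 1 := Units.ext (by
        rw [Units.val_mul, Units.val_mul, hwss, Units.val_one]; decide)
      rw [hw, hm2, one_mul] at h3
      exact h3
    · exact hwM
    · have : gu = gu * gs * gs⁻¹ := by rw [mul_inv_cancel_right]
      rw [this]; exact M.mul_mem hwM (M.inv_mem hgsM)
    · have : gu = gu * (gs * gs) * (gs * gs)⁻¹ := by rw [mul_inv_cancel_right]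
      rw [this]; exact M.mul_mem hwM (M.inv_mem (M.mul_mem hgsM hgsM))
  -- every word lies in `M`
  have hwordM : ∀ w : GL (Fin 2) (ZMod 8),
      ((w = 1 ∨ w = gs ∨ w = gs * gs) ∨ (w = gu ∨ w = gu * gs ∨ w = gu * (gs * gs))) → w ∈ M := by
    rintro w ((rfl | rfl | rfl) | (rfl | rfl | rfl))
    · exact M.one_mem
    · exact hgsM
    · exact M.mul_mem hgsM hgsM
    · exact hguM
    · exact M.mul_mem hguM hgsM
    · exact M.mul_mem hguM (M.mul_mem hgsM hgsM)
  -- every `diag(1, d)` is realised in `M`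
  have hdiag : ∀ d : (ZMod 8)ˣ, ∃ D ∈ M, (D : Matrix (Fin 2) (Fin 2) (ZMod 8)) = !![1, 0; 0, (d : ZMod 8)] := by
    intro d
    obtain ⟨md, hmdM, hmd⟩ := hdet d
    obtain ⟨w, hw, hdw, hcases⟩ := hword md
    obtain ⟨B, hBM, hB⟩ := exists_mul_eq_mul_diag red hred hsq md w hw hdw
    refine ⟨md⁻¹ * (w * B), M.mul_mem (M.inv_mem hmdM) (M.mul_mem (hwordM w hcases) hBM), ?_⟩
    rw [Units.val_mul, hB, ← Matrix.mul_assoc, ← Units.val_mul, inv_mul_cancel, Units.val_one, Matrix.one_mul,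
      hmd]
  -- conclusion
  refine eq_top_iff.mpr fun g _ ↦ ?_
  obtain ⟨w, hw, hdw, hcases⟩ := hword g
  obtain ⟨B, hBM, hB⟩ := exists_mul_eq_mul_diag red hred hsq g w hw hdw
  obtain ⟨D, hDM, hD⟩ := hdiag (Matrix.GeneralLinearGroup.det g)
  have hDD : (D : Matrix (Fin 2) (Fin 2) (ZMod 8)) * D = 1 := by
    have hdd : (g : Matrix (Fin 2) (Fin 2) (ZMod 8)).det * (g : Matrix (Fin 2) (Fin 2) (ZMod 8)).det = 1 := by
      rw [← Matrix.GeneralLinearGroup.val_det_apply]; exact units_mul_self _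
    rw [hD, Matrix.mul_fin_two]
    ext i j
    fin_cases i <;> fin_cases j <;> simp [hdd]
  have hg : g = w * B * D := by
    refine Units.ext ?_
    rw [Units.val_mul, hB, Matrix.mul_assoc, ← hD, hDD, Matrix.mul_one]
  rw [hg]
  exact M.mul_mem (M.mul_mem (hwordM w hcases) hBM) hDM

end LevelEight

end Summit.BirchSwinnertonDyer.BirchSwinnertonDyer.Theorems.GenusExact.TwoPowerImageOverK
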